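import Literature.NumberTheory.Sieve.FriedlanderIwaniecPrimesCrudeBound
import Literature.NumberTheory.Sieve.DivisorPowerSums
import HarnessLib

/-!
# Friedlander–Iwaniec, *The polynomial `X² + Y⁴` captures its primes*, §4: the trivial estimations

Family `parity`, statement parity.S17. Source: J. Friedlander, H. Iwaniec, Ann. of Math. (2) 148
(1998), 945–1040 [FriedlanderIwaniecAnnals1998], §4: the "trivial estimation" / "straightforward
estimation" steps of the reduction of Proposition 4.1 to (4.23) — (4.10) (removing `τ(n) > τ`), the
boundary terms of the smooth partition ("these boundary points contribute at most
`O(θ A(x)(log x)⁴)` by a straightforward estimation"), and the terms with small `m` before (4.19) —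
all rest on counting the lattice points `(a, c)` with `a² + c⁴` in a range and divisible by a
squarefree `n`. This file PROVES the elementary counting lemmas used for them by the sequel
`FriedlanderIwaniecPrimesBilinearReduction` (nothing here is specific to the statement of
Proposition 4.1; no named fact is introduced).

## Contents (all proved)

* `sqCongrCount_le_card_divisors_of_squarefree`: `#{ν mod n : ν² ≡ t} ≤ τ(n)` for squarefree `n`;
* `card_Icc_filter_dvd_sub_le'`, `card_Icc_filter_dvd_sq_add_le'`: arithmetic progressions and
  `a² ≡ -c⁴ (mod n)` in an arbitrary interval of integers (the tree's `card_Icc_filter_dvd_sub_le`,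
  `card_filter_dvd_sq_add_le` of `FriedlanderIwaniecPrimesCrudeBound` are the case `[-R, R]`);
* `shellRadius`, `fourthRootRange`, `shellSet`, `card_shellSet_le`: for squarefree `n ≥ 1` and
  `Y₁ ≤ Y₂`, `#{(a, c) : Y₁ < a² + c⁴ ≤ Y₂, n ∣ a² + c⁴} ≤ τ(n) ((#{a²+c⁴ ≤ Y₂} - #{a²+c⁴ ≤ Y₁})/n
  + 3 (2⌊Y₂^{1/4}⌋ + 1))` — the `1/n` of the mass of the shell plus one point per run of
  consecutive `a` (two runs and `a = 0` for each `c`);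
* `congrSum_sub_le_of_squarefree`, `congrSum_le_of_squarefree`: the same for
  `A_n(y₂) - A_n(y₁)` and `A_n(y)` (`A_n = fiSieveSeq.congrSum n`), with `A(y) = fiCount y`;
* `sum_fiRepCount_mul_le_congrSum_sub`, `sum_fiRepCount_mul_le_congrSum`: `Σ_m a_{mn} ≤ A_n`-type
  rearrangements;
* `fiCount_le_rpow` (`A(y) ≤ (4κ+14) y^{3/4}`), `fiCount_sub_le`, `fiCount_sub_thin_le`
  (`A(x) - A(x(1-θ)) ≤ 4κθ x^{3/4} + 28√x`), from the tree's proved (4.2) `abs_fiCount_sub_le`;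
* `sum_sigma_zero_sq_le_sqrt_card`: `Σ_{n ∈ I} τ(n)² ≤ √#I √(Σ_{n ≤ X} τ(n)⁴)` (Cauchy–Schwarz, for
  the short boundary ranges).

## References

* J. Friedlander, H. Iwaniec, Ann. of Math. (2) 148 (1998), 945–1040, §4, (4.9)–(4.19).
  [FriedlanderIwaniecAnnals1998]

## Tree / Mathlib

Tree: `sqCongrCount`, `sqCongrCount_prime_le`, `sqCongrCount_mul_le`, `congrSum_eq_card`,
`mem_Icc_sqrt_of_sq_le`, `mem_Icc_sqrt_sqrt_of_pow_four_le`, `nat_sqrt_sqrt_floor_le_rpow`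
(`FriedlanderIwaniecPrimesCrudeBound`, `FriedlanderIwaniecPrimes`), `fiDisc`, `card_fiDisc_eq_sum`,
`card_slice_eq`, `sum_fiRepCount_add_one`, `abs_fiCount_sub_le` (`FriedlanderIwaniecPrimes`),
`exists_sum_sigma_zero_pow_le_real` (`DivisorPowerSums`, used downstream). Mathlib:
`Nat.recOnPosPrimePosCoprime`, `Squarefree.eq_zero_or_one_of_pow_of_not_isUnit`,
`Nat.squarefree_mul_iff`, `Finset.sum_mul_sq_le_sq_mul_sq`.
-/

noncomputable section

open Filter Finset Real
open scoped ArithmeticFunction.sigma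

namespace Literature.NumberTheory.Sieve.FriedlanderIwaniecPrimes

/-! ### Square roots modulo a squarefree number -/

/-- For squarefree `n` and any `t`: `N(n, t) = #{ν mod n : ν² ≡ t} ≤ τ(n)` (`≤ 2` choices modulo each
prime factor, Chinese remainder theorem). [folklore] -/
theorem sqCongrCount_le_card_divisors_of_squarefree (t : ℤ) :
    ∀ n : ℕ, Squarefree n → sqCongrCount n t ≤ #n.divisors := by
  intro n
  induction n using Nat.recOnPosPrimePosCoprime with
  | zero => intro h; exact absurd h (by simp)
  | one => intro _; simpa using sqCongrCount_one t
  | prime_pow p k hp hk =>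
    intro hsq
    have hk1 : k = 1 := by
      rcases hsq.eq_zero_or_one_of_pow_of_not_isUnit
        (by rw [Nat.isUnit_iff]; exact hp.ne_one) with h | h
      · omega
      · exact h
    subst hk1
    rw [pow_one] at *
    rw [hp.divisors, card_pair hp.ne_one.symm]
    exact sqCongrCount_prime_le hp t
  | coprime a b ha hb hab iha ihb =>
    intro hsq
    obtain ⟨-, hsa, hsb⟩ := Nat.squarefree_mul_iff.mp hsq
    calc sqCongrCount (a * b) t ≤ sqCongrCount a t * sqCongrCount b t :=
          sqCongrCount_mul_le (by omega) (by omega) hab t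
      _ ≤ #a.divisors * #b.divisors := Nat.mul_le_mul (iha hsa) (ihb hsb)
      _ = #(a * b).divisors := (Nat.Coprime.card_divisors_mul hab).symm

/-! ### Arithmetic progressions and square-congruences in an interval of integers -/

/-- An arithmetic progression modulo `d ≥ 1` meets `[lo, hi]` in at most `(hi - lo)/d + 1` integers.
[folklore] -/
theorem card_Icc_filter_dvd_sub_le' {d : ℕ} (hd : 0 < d) (lo hi : ℤ) (ν : ℤ) :
    #{a ∈ Icc lo hi | (d : ℤ) ∣ a - ν} ≤ (hi - lo).toNat / d + 1 := by
  have hdz : (0 : ℤ) < d := by exact_mod_cast hd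
  rcases le_or_gt lo hi with hlohi | hlohi
  swap
  · rw [Finset.Icc_eq_empty (not_le.mpr hlohi)]; simp
  set L := (hi - lo).toNat with hL
  have hLz : (L : ℤ) = hi - lo := Int.toNat_of_nonneg (by linarith)
  have h1 : #{a ∈ Icc lo hi | (d : ℤ) ∣ a - ν} ≤ #(Icc (0 : ℤ) ((L / d : ℕ) : ℤ)) := by
    refine card_le_card_of_injOn (fun a => (a - lo) / (d : ℤ)) ?_ ?_
    · intro a ha
      obtain ⟨haI, -⟩ := mem_filter.mp (mem_coe.mp ha)
      rw [mem_Icc] at haI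
      rw [mem_coe, mem_Icc]
      refine ⟨Int.ediv_nonneg (by omega) hdz.le, ?_⟩
      calc (a - lo) / (d : ℤ) ≤ (L : ℤ) / (d : ℤ) := Int.ediv_le_ediv hdz (by omega)
        _ = ((L / d : ℕ) : ℤ) := by push_cast; rfl
    · intro a ha a' ha' h
      obtain ⟨-, hadvd⟩ := mem_filter.mp (mem_coe.mp ha)
      obtain ⟨-, ha'dvd⟩ := mem_filter.mp (mem_coe.mp ha')
      simp only at h
      have hsub : (d : ℤ) ∣ (a - lo) - (a' - lo) := by
        have := hadvd.sub ha'dvd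
        have e : a - ν - (a' - ν) = (a - lo) - (a' - lo) := by ring
        rwa [e] at this
      have hmod : (a' - lo) % (d : ℤ) = (a - lo) % (d : ℤ) := Int.modEq_iff_dvd.mpr hsub
      have e1 := Int.mul_ediv_add_emod (a - lo) d
      have e2 := Int.mul_ediv_add_emod (a' - lo) d
      rw [h, ← hmod] at e1
      linarith
  have hI : ∀ q : ℕ, #(Icc (0 : ℤ) (q : ℤ)) = q + 1 := fun q => by rw [Int.card_Icc]; omega
  calc _ ≤ #(Icc (0 : ℤ) ((L / d : ℕ) : ℤ)) := h1
    _ = L / d + 1 := hI _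

/-- For fixed `c`: `#{a ∈ [lo, hi] : d ∣ a² + c⁴} ≤ ((hi - lo)/d + 1) N(d, -c⁴)` (fibre over `a mod d`).
[folklore] -/
theorem card_Icc_filter_dvd_sq_add_le' {d : ℕ} (hd : 0 < d) (lo hi : ℤ) (c : ℤ) :
    #{a ∈ Icc lo hi | (d : ℤ) ∣ a ^ 2 + c ^ 4} ≤
      ((hi - lo).toNat / d + 1) * sqCongrCount d (-c ^ 4) := by
  set s := {a ∈ Icc lo hi | (d : ℤ) ∣ a ^ 2 + c ^ 4} with hs
  set f : ℤ → ℕ := fun a => (a % (d : ℤ)).toNat with hf_def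
  have hdz : (0 : ℤ) < d := by exact_mod_cast hd
  have hf : ∀ a, ((f a : ℕ) : ℤ) = a % (d : ℤ) := fun a =>
    Int.toNat_of_nonneg (Int.emod_nonneg _ hdz.ne')
  have h1 : #s ≤ ((hi - lo).toNat / d + 1) * #(s.image f) := by
    refine card_le_mul_card_image s _ fun ν _ => ?_
    calc #(s.filter fun a => f a = ν) ≤ #{a ∈ Icc lo hi | (d : ℤ) ∣ a - (ν : ℤ)} := by
          refine card_le_card fun a ha => ?_
          obtain ⟨has, hfa⟩ := mem_filter.mp ha
          refine mem_filter.mpr ⟨(mem_filter.mp has).1, ?_⟩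
          rw [← hfa, hf a, Int.emod_def]
          exact ⟨a / d, by ring⟩
      _ ≤ (hi - lo).toNat / d + 1 := card_Icc_filter_dvd_sub_le' hd lo hi ν
  have h2 : s.image f ⊆ (range d).filter fun ν : ℕ => (d : ℤ) ∣ (ν : ℤ) ^ 2 - -c ^ 4 := by
    intro ν hν
    obtain ⟨a, ha, rfl⟩ := mem_image.mp hν
    obtain ⟨-, hdvd⟩ := mem_filter.mp ha
    refine mem_filter.mpr ⟨mem_range.mpr ?_, ?_⟩
    · have : ((f a : ℕ) : ℤ) < d := by rw [hf]; exact Int.emod_lt_of_pos _ hdz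
      exact_mod_cast this
    · rw [hf a]
      have e : (a % (d : ℤ)) ^ 2 - -c ^ 4 =
          (a ^ 2 + c ^ 4) - (d : ℤ) * ((a / d) * (2 * a - d * (a / d))) := by
        rw [Int.emod_def]; ring
      rw [e]
      exact hdvd.sub (dvd_mul_right _ _)
  calc #s ≤ ((hi - lo).toNat / d + 1) * #(s.image f) := h1
    _ ≤ ((hi - lo).toNat / d + 1) * sqCongrCount d (-c ^ 4) :=
        Nat.mul_le_mul_left _ (card_le_card h2)


/-! ### Points of `a² + c⁴ ≡ 0 (mod n)` in a shell `Y₁ < a² + c⁴ ≤ Y₂` -/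

/-- The integer part of `√(Y - c⁴)` (`0` if `c⁴ > Y`): the largest `a ≥ 0` with `a² + c⁴ ≤ Y`.
[folklore] -/
def shellRadius (Y : ℕ) (c : ℤ) : ℕ := Nat.sqrt ((Y : ℤ) - c ^ 4).toNat

/-- `shellRadius` is monotone in `Y`. [folklore] -/
theorem shellRadius_mono {Y₁ Y₂ : ℕ} (h : Y₁ ≤ Y₂) (c : ℤ) : shellRadius Y₁ c ≤ shellRadius Y₂ c := by
  unfold shellRadius
  apply Nat.sqrt_le_sqrt
  apply Int.toNat_le_toNat
  have : (Y₁ : ℤ) ≤ Y₂ := by exact_mod_cast h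
  linarith

/-- A positive `a` with `a² + c⁴ ≤ Y` has `a ≤ shellRadius Y c`. [folklore] -/
theorem le_shellRadius_of_sq_add_le {Y : ℕ} {a c : ℤ} (h : a ^ 2 + c ^ 4 ≤ (Y : ℤ)) :
    a ≤ shellRadius Y c := by
  unfold shellRadius
  set M := ((Y : ℤ) - c ^ 4).toNat with hM
  have hc0 : 0 ≤ c ^ 4 := by positivity
  have hMz : (M : ℤ) = Y - c ^ 4 := Int.toNat_of_nonneg (by nlinarith [sq_nonneg a])
  have : a ^ 2 ≤ (M : ℤ) := by rw [hMz]; linarith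
  exact (mem_Icc.mp (mem_Icc_sqrt_of_sq_le this)).2

/-- A positive `a` with `a² + c⁴ > Y` has `shellRadius Y c < a`. [folklore] -/
theorem shellRadius_lt_of_lt_sq_add {Y : ℕ} {a c : ℤ} (ha : 0 < a) (h : (Y : ℤ) < a ^ 2 + c ^ 4) :
    (shellRadius Y c : ℤ) < a := by
  unfold shellRadius
  set M := ((Y : ℤ) - c ^ 4).toNat with hM
  by_contra hle
  rw [not_lt] at hle
  -- `a ≤ √M`, so `a² ≤ M`
  have hs : ((Nat.sqrt M) ^ 2 : ℕ) ≤ M := Nat.sqrt_le' M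
  have hs' : (Nat.sqrt M : ℤ) ^ 2 ≤ M := by exact_mod_cast hs
  have ha2 : a ^ 2 ≤ (M : ℤ) := by nlinarith
  rcases le_or_gt (c ^ 4) (Y : ℤ) with hcY | hcY
  · have hMz : (M : ℤ) = Y - c ^ 4 := Int.toNat_of_nonneg (by linarith)
    rw [hMz] at ha2
    linarith
  · have hM0 : M = 0 := by rw [hM]; exact Int.toNat_of_nonpos (by linarith)
    rw [hM0] at ha2
    push_cast at ha2
    nlinarith

/-- The fibre over `c` of the shell count, for squarefree `n ≥ 1`:
`#{a ∈ [-Y₂, Y₂] : Y₁ < a² + c⁴ ≤ Y₂, n ∣ a² + c⁴} ≤ τ(n) (2((r₂ - r₁)/n + 1) + 1)` with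
`rᵢ = shellRadius Yᵢ c` (positive `a` lie in `(r₁, r₂]`, negative ones in its mirror image, and
`a = 0` is one more point; in each run of consecutive integers an arithmetic progression is counted
by `card_Icc_filter_dvd_sq_add_le'`, and `N(n, -c⁴) ≤ τ(n)`). [folklore] -/
theorem card_shellFibre_le {n : ℕ} (hn : 0 < n) (hsq : Squarefree n) {Y₁ Y₂ : ℕ} (hY : Y₁ ≤ Y₂)
    (c : ℤ) :
    #{a ∈ Icc (-(Y₂ : ℤ)) Y₂ | (Y₁ : ℤ) < a ^ 2 + c ^ 4 ∧ a ^ 2 + c ^ 4 ≤ (Y₂ : ℤ) ∧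
        (n : ℤ) ∣ a ^ 2 + c ^ 4} ≤
      #n.divisors * (2 * ((shellRadius Y₂ c - shellRadius Y₁ c) / n + 1) + 1) := by
  set r₁ := shellRadius Y₁ c with hr₁
  set r₂ := shellRadius Y₂ c with hr₂
  set F := {a ∈ Icc (-(Y₂ : ℤ)) Y₂ | (Y₁ : ℤ) < a ^ 2 + c ^ 4 ∧ a ^ 2 + c ^ 4 ≤ (Y₂ : ℤ) ∧
        (n : ℤ) ∣ a ^ 2 + c ^ 4} with hF
  set Fp := {a ∈ Icc ((r₁ : ℤ) + 1) r₂ | (n : ℤ) ∣ a ^ 2 + c ^ 4} with hFp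
  -- positive elements of `F` lie in `Fp`
  have hpos : ∀ a ∈ F, 0 < a → a ∈ Fp := by
    intro a ha ha0
    obtain ⟨-, h1, h2, h3⟩ := mem_filter.mp ha
    refine mem_filter.mpr ⟨mem_Icc.mpr ⟨?_, le_shellRadius_of_sq_add_le h2⟩, h3⟩
    have := shellRadius_lt_of_lt_sq_add ha0 h1
    omega
  have hneg : ∀ a ∈ F, a < 0 → a ∈ Fp.image Neg.neg := by
    intro a ha ha0
    obtain ⟨-, h1, h2, h3⟩ := mem_filter.mp ha
    refine mem_image.mpr ⟨-a, ?_, neg_neg a⟩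
    have e : (-a) ^ 2 + c ^ 4 = a ^ 2 + c ^ 4 := by ring
    refine mem_filter.mpr ⟨mem_Icc.mpr ⟨?_, ?_⟩, ?_⟩
    · have := shellRadius_lt_of_lt_sq_add (a := -a) (by omega) (by rw [e]; exact h1)
      omega
    · exact le_shellRadius_of_sq_add_le (by rw [e]; exact h2)
    · rw [e]; exact h3
  have hsub : F ⊆ Fp ∪ Fp.image Neg.neg ∪ {0} := by
    intro a ha
    rcases lt_trichotomy a 0 with h | h | h
    · exact mem_union_left _ (mem_union_right _ (hneg a ha h))
    · simp [h]
    · exact mem_union_left _ (mem_union_left _ (hpos a ha h))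
  have hFp : #Fp ≤ ((r₂ - r₁) / n + 1) * #n.divisors := by
    calc #Fp ≤ (((r₂ : ℤ) - ((r₁ : ℤ) + 1)).toNat / n + 1) * sqCongrCount n (-c ^ 4) :=
          card_Icc_filter_dvd_sq_add_le' hn _ _ c
      _ ≤ ((r₂ - r₁) / n + 1) * #n.divisors := by
          apply Nat.mul_le_mul
          · apply Nat.add_le_add_right
            apply Nat.div_le_div_right
            have : ((r₂ : ℤ) - ((r₁ : ℤ) + 1)).toNat ≤ ((r₂ : ℤ) - (r₁ : ℤ)).toNat :=
              Int.toNat_le_toNat (by linarith)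
            refine this.trans ?_
            rw [show ((r₂ : ℤ) - (r₁ : ℤ)) = ((r₂ - r₁ : ℕ) : ℤ) from ?_, Int.toNat_natCast]
            have : r₁ ≤ r₂ := shellRadius_mono hY c
            push_cast [this]; ring
          · exact sqCongrCount_le_card_divisors_of_squarefree _ n hsq
  have h1 : 1 ≤ #n.divisors := one_le_card_divisors hn.ne'
  calc #F ≤ #(Fp ∪ Fp.image Neg.neg ∪ {0}) := card_le_card hsub
    _ ≤ #(Fp ∪ Fp.image Neg.neg) + #({0} : Finset ℤ) := card_union_le _ _
    _ ≤ #Fp + #(Fp.image Neg.neg) + 1 := by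
        rw [card_singleton]; exact Nat.add_le_add_right (card_union_le _ _) 1
    _ ≤ #Fp + #Fp + 1 := Nat.add_le_add_right (Nat.add_le_add_left Finset.card_image_le _) 1
    _ ≤ ((r₂ - r₁) / n + 1) * #n.divisors + ((r₂ - r₁) / n + 1) * #n.divisors + #n.divisors := by
        gcongr
    _ = #n.divisors * (2 * ((r₂ - r₁) / n + 1) + 1) := by ring

/-- The `c` with `c⁴ ≤ Y`, inside `[-Y, Y]`. [folklore] -/
def fourthRootRange (Y : ℕ) : Finset ℤ := (Icc (-(Y : ℤ)) Y).filter fun c => c ^ 4 ≤ (Y : ℤ)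

/-- `#{c : c⁴ ≤ Y} ≤ 2 ⌊Y^{1/4}⌋ + 1`. [folklore] -/
theorem card_fourthRootRange_le (Y : ℕ) : #(fourthRootRange Y) ≤ 2 * Nat.sqrt (Nat.sqrt Y) + 1 := by
  have hsub : fourthRootRange Y ⊆ Icc (-(Nat.sqrt (Nat.sqrt Y) : ℤ)) (Nat.sqrt (Nat.sqrt Y)) :=
    fun c hc => mem_Icc_sqrt_sqrt_of_pow_four_le (mem_filter.mp hc).2
  refine (card_le_card hsub).trans ?_
  rw [Int.card_Icc]; omega

/-- `c⁴ ≤ Y` forces `|c| ≤ Y`. [folklore] -/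
theorem mem_Icc_of_pow_four_le {c : ℤ} {Y : ℕ} (h : c ^ 4 ≤ (Y : ℤ)) : c ∈ Icc (-(Y : ℤ)) Y := by
  have h1 : (c.natAbs : ℤ) ≤ c ^ 2 := Int.natAbs_le_self_sq c
  have h2 : c ^ 2 ≤ c ^ 4 := by
    calc c ^ 2 ≤ (c ^ 2) ^ 2 := Int.le_self_sq _
      _ = c ^ 4 := by ring
  rw [mem_Icc]
  constructor <;> omega

/-- `#{a² + c⁴ ≤ Y} = Σ_{c⁴ ≤ Y} (2 r(Y, c) + 1)`. [folklore] -/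
theorem card_fiDisc_eq_sum_fourthRootRange (Y : ℕ) :
    #(fiDisc Y) = ∑ c ∈ fourthRootRange Y, (2 * shellRadius Y c + 1) := by
  rw [card_fiDisc_eq_sum, fourthRootRange, Finset.sum_filter]
  refine Finset.sum_congr rfl fun c _ => ?_
  split_ifs with h
  · rw [card_slice_eq h]; rfl
  · exact card_slice_eq_zero (not_le.mp h)

/-- For `Y₁ ≤ Y₂`: `#{a² + c⁴ ≤ Y₁} ≤ Σ_{c⁴ ≤ Y₂} (2 r(Y₁, c) + 1)`. [folklore] -/
theorem card_fiDisc_le_sum_fourthRootRange {Y₁ Y₂ : ℕ} (hY : Y₁ ≤ Y₂) :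
    #(fiDisc Y₁) ≤ ∑ c ∈ fourthRootRange Y₂, (2 * shellRadius Y₁ c + 1) := by
  rw [card_fiDisc_eq_sum_fourthRootRange Y₁]
  refine Finset.sum_le_sum_of_subset_of_nonneg (fun c hc => ?_) fun _ _ _ => Nat.zero_le _
  have h := (mem_filter.mp hc).2
  have hY' : (Y₁ : ℤ) ≤ Y₂ := by exact_mod_cast hY
  exact mem_filter.mpr ⟨mem_Icc_of_pow_four_le (h.trans hY'), h.trans hY'⟩

/-- `2 Σ_{c⁴ ≤ Y₂} (r(Y₂, c) - r(Y₁, c)) ≤ #fiDisc Y₂ - #fiDisc Y₁` for `Y₁ ≤ Y₂`. [folklore] -/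
theorem two_mul_sum_shellRadius_sub_le {Y₁ Y₂ : ℕ} (hY : Y₁ ≤ Y₂) :
    2 * ∑ c ∈ fourthRootRange Y₂, ((shellRadius Y₂ c : ℝ) - shellRadius Y₁ c) ≤
      (#(fiDisc Y₂) : ℝ) - #(fiDisc Y₁) := by
  have h2 := card_fiDisc_eq_sum_fourthRootRange Y₂
  have h1 := card_fiDisc_le_sum_fourthRootRange hY
  have h2' : (#(fiDisc Y₂) : ℝ) = ∑ c ∈ fourthRootRange Y₂, (2 * (shellRadius Y₂ c : ℝ) + 1) := by
    rw [h2]; push_cast; rfl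
  have h1' : (#(fiDisc Y₁) : ℝ) ≤ ∑ c ∈ fourthRootRange Y₂, (2 * (shellRadius Y₁ c : ℝ) + 1) := by
    have : ((#(fiDisc Y₁) : ℕ) : ℝ) ≤ ((∑ c ∈ fourthRootRange Y₂, (2 * shellRadius Y₁ c + 1) : ℕ) : ℝ) := by
      exact_mod_cast h1
    refine this.trans_eq ?_
    push_cast; rfl
  rw [h2', Finset.mul_sum]
  have e : ∑ c ∈ fourthRootRange Y₂, 2 * ((shellRadius Y₂ c : ℝ) - shellRadius Y₁ c) =
      ∑ c ∈ fourthRootRange Y₂, (2 * (shellRadius Y₂ c : ℝ) + 1) -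
        ∑ c ∈ fourthRootRange Y₂, (2 * (shellRadius Y₁ c : ℝ) + 1) := by
    rw [← Finset.sum_sub_distrib]; refine Finset.sum_congr rfl fun c _ => ?_; ring
  rw [e]
  linarith

/-- The shell, as a set of lattice points: `{(a, c) ∈ [-Y₂, Y₂]² : Y₁ < a² + c⁴ ≤ Y₂, n ∣ a² + c⁴}`.
[folklore] -/
def shellSet (n Y₁ Y₂ : ℕ) : Finset (ℤ × ℤ) :=
  {P ∈ fiBox Y₂ | (Y₁ : ℤ) < P.1 ^ 2 + P.2 ^ 4 ∧ P.1 ^ 2 + P.2 ^ 4 ≤ (Y₂ : ℤ) ∧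
    (n : ℤ) ∣ P.1 ^ 2 + P.2 ^ 4}

/-- **Shell count for squarefree moduli**: for squarefree `n ≥ 1` and `Y₁ ≤ Y₂`,
`#{(a, c) : Y₁ < a² + c⁴ ≤ Y₂, n ∣ a² + c⁴} ≤ τ(n) ((#{a²+c⁴ ≤ Y₂} - #{a²+c⁴ ≤ Y₁})/n + 3 (2⌊Y₂^{1/4}⌋ + 1))`.
[folklore] -/
theorem card_shellSet_le {n : ℕ} (hn : 0 < n) (hsq : Squarefree n) {Y₁ Y₂ : ℕ} (hY : Y₁ ≤ Y₂) :
    (#(shellSet n Y₁ Y₂) : ℝ) ≤ #n.divisors *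
      (((#(fiDisc Y₂) : ℝ) - #(fiDisc Y₁)) / n + 3 * (2 * Nat.sqrt (Nat.sqrt Y₂) + 1)) := by
  -- slice by `c`
  let g : ℤ → ℕ := fun c => #{a ∈ Icc (-(Y₂ : ℤ)) Y₂ | (Y₁ : ℤ) < a ^ 2 + c ^ 4 ∧
      a ^ 2 + c ^ 4 ≤ (Y₂ : ℤ) ∧ (n : ℤ) ∣ a ^ 2 + c ^ 4}
  have hslice : #(shellSet n Y₁ Y₂) = ∑ c ∈ Icc (-(Y₂ : ℤ)) Y₂, g c := by
    rw [shellSet, fiBox, card_filter, sum_product_right]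
    refine sum_congr rfl fun c _ => ?_
    simp only [g, card_filter]
  -- slices with `c⁴ > Y₂` are empty
  have hzero : ∀ c ∈ Icc (-(Y₂ : ℤ)) Y₂, ¬ c ^ 4 ≤ (Y₂ : ℤ) → g c = 0 := by
    intro c _ hc
    simp only [g]
    rw [card_eq_zero, filter_eq_empty_iff]
    rintro a - ⟨-, h2, -⟩
    exact hc (by nlinarith [sq_nonneg a])
  have hslice' : #(shellSet n Y₁ Y₂) = ∑ c ∈ fourthRootRange Y₂, g c := by
    rw [hslice, fourthRootRange, Finset.sum_filter]
    refine sum_congr rfl fun c hc => ?_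
    split_ifs with h
    · rfl
    · exact hzero c hc h
  -- the fibre bound, in `ℝ`
  have hfib : ∀ c ∈ fourthRootRange Y₂, (g c : ℝ) ≤ #n.divisors *
      (2 * (((shellRadius Y₂ c : ℝ) - shellRadius Y₁ c) / n + 1) + 1) := by
    intro c _
    have h := card_shellFibre_le hn hsq hY c
    have hr : shellRadius Y₁ c ≤ shellRadius Y₂ c := shellRadius_mono hY c
    have hdiv : (((shellRadius Y₂ c - shellRadius Y₁ c) / n : ℕ) : ℝ) ≤
        ((shellRadius Y₂ c : ℝ) - shellRadius Y₁ c) / n := by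
      rw [← Nat.cast_sub hr]; exact Nat.cast_div_le
    calc (g c : ℝ) ≤ ((#n.divisors * (2 * ((shellRadius Y₂ c - shellRadius Y₁ c) / n + 1) + 1) : ℕ) : ℝ) := by
          exact_mod_cast h
      _ = #n.divisors * (2 * ((((shellRadius Y₂ c - shellRadius Y₁ c) / n : ℕ) : ℝ) + 1) + 1) := by
          push_cast; ring
      _ ≤ _ := by gcongr
  have hτ0 : (0 : ℝ) ≤ #n.divisors := Nat.cast_nonneg _
  have hn0 : (0 : ℝ) < n := by exact_mod_cast hn
  calc (#(shellSet n Y₁ Y₂) : ℝ) = ∑ c ∈ fourthRootRange Y₂, (g c : ℝ) := by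
        rw [hslice']; push_cast; rfl
    _ ≤ ∑ c ∈ fourthRootRange Y₂, #n.divisors *
          (2 * (((shellRadius Y₂ c : ℝ) - shellRadius Y₁ c) / n + 1) + 1) := sum_le_sum hfib
    _ = #n.divisors * ∑ c ∈ fourthRootRange Y₂,
          (2 * (((shellRadius Y₂ c : ℝ) - shellRadius Y₁ c) / n) + 3) := by
        rw [Finset.mul_sum]; refine sum_congr rfl fun c _ => ?_; ring
    _ = #n.divisors * ((2 * ∑ c ∈ fourthRootRange Y₂,
          ((shellRadius Y₂ c : ℝ) - shellRadius Y₁ c)) / n + 3 * #(fourthRootRange Y₂)) := by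
        congr 1
        rw [Finset.sum_add_distrib, Finset.sum_const, nsmul_eq_mul, Finset.mul_sum, Finset.sum_div]
        congr 1
        · exact sum_congr rfl fun c _ => by ring
        · ring
    _ ≤ #n.divisors * (((#(fiDisc Y₂) : ℝ) - #(fiDisc Y₁)) / n + 3 * (2 * Nat.sqrt (Nat.sqrt Y₂) + 1)) := by
        gcongr
        · exact two_mul_sum_shellRadius_sub_le hY
        · exact_mod_cast card_fourthRootRange_le Y₂


/-! ### From lattice points to `A_n(y₂) - A_n(y₁)` and `Σ_m a_{mn}` -/

/-- `a² + c⁴ ≤ Y` puts `(a, c)` in the box `[-Y, Y]²`. [folklore] -/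
theorem mem_fiBox_of_sq_add_pow_four_le {a c : ℤ} {Y : ℕ} (h : a ^ 2 + c ^ 4 ≤ (Y : ℤ)) :
    (a, c) ∈ fiBox Y := by
  have hc2 : c ^ 2 ≤ c ^ 4 := by
    calc c ^ 2 ≤ (c ^ 2) ^ 2 := Int.le_self_sq _
      _ = c ^ 4 := by ring
  exact mem_fiBox_of_sq_le (by nlinarith [sq_nonneg (c ^ 2)]) (by nlinarith [sq_nonneg a])

/-- `A_n(y₂) - A_n(y₁) ≤ #shellSet n ⌊y₁⌋ ⌊y₂⌋` for `y₁ ≤ y₂` (the points of `fiPoints ⌊y₂⌋` divisible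
by `n` and not already counted below `y₁` lie in the shell). [folklore] -/
theorem congrSum_sub_le_card_shellSet (n : ℕ) {y₁ y₂ : ℝ} (hy : y₁ ≤ y₂) :
    fiSieveSeq.congrSum n y₂ - fiSieveSeq.congrSum n y₁ ≤ #(shellSet n ⌊y₁⌋₊ ⌊y₂⌋₊) := by
  have hY : ⌊y₁⌋₊ ≤ ⌊y₂⌋₊ := Nat.floor_le_floor hy
  set T₁ := {P ∈ fiPoints ⌊y₁⌋₊ | n ∣ fiQuartic P} with hT₁
  set T₂ := {P ∈ fiPoints ⌊y₂⌋₊ | n ∣ fiQuartic P} with hT₂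
  rw [congrSum_eq_card, congrSum_eq_card]
  have hsub : T₁ ⊆ T₂ := by
    intro P hP
    obtain ⟨hP1, hP2⟩ := mem_filter.mp hP
    obtain ⟨hb, hq⟩ := mem_filter.mp hP1
    refine mem_filter.mpr ⟨mem_filter.mpr ⟨?_, ?_⟩, hP2⟩
    · simp only [fiBox, mem_product, mem_Icc] at hb ⊢
      have : (⌊y₁⌋₊ : ℤ) ≤ ⌊y₂⌋₊ := by exact_mod_cast hY
      omega
    · rw [mem_Icc] at hq ⊢; exact ⟨hq.1, hq.2.trans hY⟩
  have hdiff : T₂ \ T₁ ⊆ shellSet n ⌊y₁⌋₊ ⌊y₂⌋₊ := by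
    intro P hP
    rw [Finset.mem_sdiff] at hP
    obtain ⟨hP2, hP1⟩ := hP
    obtain ⟨hPp, hdvd⟩ := mem_filter.mp hP2
    obtain ⟨hbox, hq⟩ := mem_filter.mp hPp
    rw [mem_Icc] at hq
    have hq' : (fiQuartic P : ℤ) = P.1 ^ 2 + P.2 ^ 4 := fiQuartic_cast P
    refine mem_filter.mpr ⟨hbox, ?_, ?_, ?_⟩
    · -- `q(P) > ⌊y₁⌋`, else `P ∈ T₁`
      by_contra hle
      rw [not_lt, ← hq'] at hle
      have hle' : fiQuartic P ≤ ⌊y₁⌋₊ := by exact_mod_cast hle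
      apply hP1
      refine mem_filter.mpr ⟨mem_filter.mpr ⟨?_, mem_Icc.mpr ⟨hq.1, hle'⟩⟩, hdvd⟩
      have : P.1 ^ 2 + P.2 ^ 4 ≤ (⌊y₁⌋₊ : ℤ) := by rw [← hq']; exact_mod_cast hle'
      exact mem_fiBox_of_sq_add_pow_four_le this
    · rw [← hq']; exact_mod_cast hq.2
    · rw [← hq']; exact_mod_cast hdvd
  have h := card_le_card hdiff
  rw [card_sdiff_of_subset hsub] at h
  have h' : (#T₂ : ℝ) - #T₁ ≤ #(shellSet n ⌊y₁⌋₊ ⌊y₂⌋₊) := by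
    have hle : #T₁ ≤ #T₂ := card_le_card hsub
    have : ((#T₂ - #T₁ : ℕ) : ℝ) ≤ #(shellSet n ⌊y₁⌋₊ ⌊y₂⌋₊) := by exact_mod_cast h
    rwa [Nat.cast_sub hle] at this
  exact h'

/-- `#{a² + c⁴ ≤ ⌊y⌋} = A(y) + 1`. [folklore] -/
theorem card_fiDisc_floor (y : ℝ) : (#(fiDisc ⌊y⌋₊) : ℝ) = fiCount y + 1 := by
  rw [← sum_fiRepCount_add_one, fiCount]; push_cast; rfl

/-- **`A_n` in shells, squarefree moduli**: for squarefree `n ≥ 1` and `0 ≤ y₁ ≤ y₂`,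
`A_n(y₂) - A_n(y₁) ≤ τ(n) ((A(y₂) - A(y₁))/n + 3 (2 y₂^{1/4} + 1))`. [folklore] -/
theorem congrSum_sub_le_of_squarefree {n : ℕ} (hn : 0 < n) (hsq : Squarefree n) {y₁ y₂ : ℝ}
    (hy₁ : 0 ≤ y₁) (hy : y₁ ≤ y₂) :
    fiSieveSeq.congrSum n y₂ - fiSieveSeq.congrSum n y₁ ≤
      #n.divisors * ((fiCount y₂ - fiCount y₁) / n + 3 * (2 * y₂ ^ (1 / 4 : ℝ) + 1)) := by
  have hY : ⌊y₁⌋₊ ≤ ⌊y₂⌋₊ := Nat.floor_le_floor hy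
  have h1 := congrSum_sub_le_card_shellSet n hy
  have h2 := card_shellSet_le hn hsq hY
  rw [card_fiDisc_floor, card_fiDisc_floor] at h2
  have h3 : ((Nat.sqrt (Nat.sqrt ⌊y₂⌋₊) : ℕ) : ℝ) ≤ y₂ ^ (1 / 4 : ℝ) :=
    nat_sqrt_sqrt_floor_le_rpow (hy₁.trans hy)
  have hτ : (0 : ℝ) ≤ #n.divisors := Nat.cast_nonneg _
  calc fiSieveSeq.congrSum n y₂ - fiSieveSeq.congrSum n y₁ ≤ #(shellSet n ⌊y₁⌋₊ ⌊y₂⌋₊) := h1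
    _ ≤ #n.divisors * ((fiCount y₂ + 1 - (fiCount y₁ + 1)) / n +
          3 * (2 * Nat.sqrt (Nat.sqrt ⌊y₂⌋₊) + 1)) := h2
    _ = #n.divisors * ((fiCount y₂ - fiCount y₁) / n + 3 * (2 * Nat.sqrt (Nat.sqrt ⌊y₂⌋₊) + 1)) := by
        ring
    _ ≤ #n.divisors * ((fiCount y₂ - fiCount y₁) / n + 3 * (2 * y₂ ^ (1 / 4 : ℝ) + 1)) := by
        gcongr

/-- `A_n(0) = 0`. [folklore] -/
theorem congrSum_zero_right (n : ℕ) : fiSieveSeq.congrSum n 0 = 0 := by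
  simp [SieveSequence.congrSum]

/-- `A(0) = 0`. [folklore] -/
theorem fiCount_zero : fiCount 0 = 0 := by simp [fiCount]

/-- **`A_n(y)` for squarefree `n ≥ 1`**: `A_n(y) ≤ τ(n) (A(y)/n + 3 (2 y^{1/4} + 1))` (`y ≥ 0`).
[folklore] -/
theorem congrSum_le_of_squarefree {n : ℕ} (hn : 0 < n) (hsq : Squarefree n) {y : ℝ} (hy : 0 ≤ y) :
    fiSieveSeq.congrSum n y ≤ #n.divisors * (fiCount y / n + 3 * (2 * y ^ (1 / 4 : ℝ) + 1)) := by
  have h := congrSum_sub_le_of_squarefree hn hsq le_rfl hy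
  rwa [congrSum_zero_right, fiCount_zero, sub_zero, sub_zero] at h

/-- `Σ_{m ∈ S} a_{mn} ≤ A_n(y₂) - A_n(y₁)` whenever every `m ∈ S` has `m ≥ 1` and `y₁ < mn ≤ y₂`
(`m ↦ mn` is injective into the multiples of `n` in `(y₁, y₂]`). [folklore] -/
theorem sum_fiRepCount_mul_le_congrSum_sub {n : ℕ} (hn : 0 < n) {y₁ y₂ : ℝ} (hy₁ : 0 ≤ y₁)
    (hy : y₁ ≤ y₂) (S : Finset ℕ)
    (hS : ∀ m ∈ S, y₁ < (m * n : ℕ) ∧ ((m * n : ℕ) : ℝ) ≤ y₂) :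
    ∑ m ∈ S, (fiRepCount (m * n) : ℝ) ≤ fiSieveSeq.congrSum n y₂ - fiSieveSeq.congrSum n y₁ := by
  have hY : ⌊y₁⌋₊ ≤ ⌊y₂⌋₊ := Nat.floor_le_floor hy
  -- `A_n(y₂) - A_n(y₁)` as a sum over `(⌊y₁⌋, ⌊y₂⌋]`
  have hsplit : fiSieveSeq.congrSum n y₂ - fiSieveSeq.congrSum n y₁ =
      ∑ k ∈ (Ioc ⌊y₁⌋₊ ⌊y₂⌋₊).filter (n ∣ ·), (fiRepCount k : ℝ) := by
    simp only [SieveSequence.congrSum]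
    rw [← Finset.Ioc_union_Ioc_eq_Ioc (Nat.zero_le _) hY, Finset.filter_union,
      Finset.sum_union]
    · simp [fiSieveSeq]
    · exact Finset.disjoint_filter_filter ((Finset.Ioc_disjoint_Ioc_of_le le_rfl))
  rw [hsplit]
  have hinj : Set.InjOn (fun m : ℕ => m * n) S := fun a _ b _ h => Nat.eq_of_mul_eq_mul_right hn h
  rw [← Finset.sum_image (f := fun k => (fiRepCount k : ℝ)) hinj]
  refine Finset.sum_le_sum_of_subset_of_nonneg (fun k hk => ?_) fun _ _ _ => Nat.cast_nonneg _
  obtain ⟨m, hm, rfl⟩ := mem_image.mp hk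
  obtain ⟨h1, h2⟩ := hS m hm
  refine mem_filter.mpr ⟨mem_Ioc.mpr ⟨(Nat.floor_lt hy₁).mpr h1, Nat.le_floor h2⟩, dvd_mul_left n m⟩

/-- Special case `y₁ = 0`: `Σ_{m ∈ S} a_{mn} ≤ A_n(y)` if `mn ≤ y` on `S` (and `m ≥ 1`). [folklore] -/
theorem sum_fiRepCount_mul_le_congrSum {n : ℕ} (hn : 0 < n) {y : ℝ} (hy : 0 ≤ y) (S : Finset ℕ)
    (hS : ∀ m ∈ S, 1 ≤ m ∧ ((m * n : ℕ) : ℝ) ≤ y) :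
    ∑ m ∈ S, (fiRepCount (m * n) : ℝ) ≤ fiSieveSeq.congrSum n y := by
  have h := sum_fiRepCount_mul_le_congrSum_sub hn le_rfl hy S fun m hm => ⟨?_, (hS m hm).2⟩
  · rwa [congrSum_zero_right, sub_zero] at h
  · have : 1 ≤ m * n := Nat.one_le_iff_ne_zero.mpr (Nat.mul_ne_zero_iff.mpr ⟨by
      have := (hS m hm).1; omega, hn.ne'⟩)
    exact_mod_cast this

/-! ### The size of `A(y)` and of shells of `A` ((4.2), proved in the tree) -/

/-- `A(y) ≤ (4κ + 14) y^{3/4}` for `y ≥ 1` ((4.2): `|A(y) - 4κ y^{3/4}| ≤ 14 √y`). [folklore] -/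
theorem fiCount_le_rpow {y : ℝ} (hy : 1 ≤ y) :
    fiCount y ≤ (4 * friedlanderIwaniecKappa + 14) * y ^ (3 / 4 : ℝ) := by
  have h := abs_fiCount_sub_le hy
  have hs : Real.sqrt y ≤ y ^ (3 / 4 : ℝ) := by
    rw [Real.sqrt_eq_rpow]
    exact Real.rpow_le_rpow_of_exponent_le hy (by norm_num)
  have := (abs_le.mp h).2
  nlinarith [friedlanderIwaniecKappa_pos]

/-- Shells of `A`: for `1 ≤ y₁ ≤ y₂`, `A(y₂) - A(y₁) ≤ 4κ (y₂^{3/4} - y₁^{3/4}) + 28 √y₂`. [folklore] -/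
theorem fiCount_sub_le {y₁ y₂ : ℝ} (hy₁ : 1 ≤ y₁) (hy : y₁ ≤ y₂) :
    fiCount y₂ - fiCount y₁ ≤
      4 * friedlanderIwaniecKappa * (y₂ ^ (3 / 4 : ℝ) - y₁ ^ (3 / 4 : ℝ)) + 28 * Real.sqrt y₂ := by
  have h2 := (abs_le.mp (abs_fiCount_sub_le (hy₁.trans hy))).2
  have h1 := (abs_le.mp (abs_fiCount_sub_le hy₁)).1
  have hs : Real.sqrt y₁ ≤ Real.sqrt y₂ := Real.sqrt_le_sqrt hy
  linarith

/-- The thin shell `(x(1-θ), x]`: `A(x) - A(x(1-θ)) ≤ 4κ θ x^{3/4} + 28 √x` for `0 ≤ θ ≤ 1`,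
`x(1-θ) ≥ 1` (since `(1-θ)^{3/4} ≥ 1 - θ`). [folklore] -/
theorem fiCount_sub_thin_le {x θ : ℝ} (hθ0 : 0 ≤ θ) (hθ1 : θ ≤ 1) (hx : 1 ≤ x * (1 - θ)) :
    fiCount x - fiCount (x * (1 - θ)) ≤
      4 * friedlanderIwaniecKappa * θ * x ^ (3 / 4 : ℝ) + 28 * Real.sqrt x := by
  have h1θ : 0 ≤ 1 - θ := by linarith
  have hx0 : 0 ≤ x := by nlinarith
  have hxx : x * (1 - θ) ≤ x := by nlinarith
  have h := fiCount_sub_le hx hxx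
  have hpow : x ^ (3 / 4 : ℝ) - (x * (1 - θ)) ^ (3 / 4 : ℝ) ≤ θ * x ^ (3 / 4 : ℝ) := by
    rw [Real.mul_rpow hx0 h1θ]
    have h2 : 1 - θ ≤ (1 - θ) ^ (3 / 4 : ℝ) :=
      Real.self_le_rpow_of_le_one h1θ (by linarith) (by norm_num)
    have h3 : 0 ≤ x ^ (3 / 4 : ℝ) := Real.rpow_nonneg hx0 _
    nlinarith
  nlinarith [friedlanderIwaniecKappa_pos]

/-! ### Divisor sums: Cauchy–Schwarz on a short range -/

/-- `Σ_{n ∈ I} τ(n)² ≤ √#I · √(Σ_{n ≤ X} τ(n)⁴)` for `I ⊆ [1, X]` (Cauchy–Schwarz). [folklore] -/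
theorem sum_sigma_zero_sq_le_sqrt_card {I : Finset ℕ} {X : ℕ} (hI : I ⊆ Icc 1 X) :
    ∑ n ∈ I, ((σ 0 n : ℕ) : ℝ) ^ 2 ≤
      Real.sqrt #I * Real.sqrt (∑ n ∈ Icc 1 X, ((σ 0 n : ℕ) : ℝ) ^ 4) := by
  have hcs := Finset.sum_mul_sq_le_sq_mul_sq I (fun _ => (1 : ℝ)) (fun n => ((σ 0 n : ℕ) : ℝ) ^ 2)
  simp only [one_pow, sum_const, nsmul_eq_mul, mul_one, one_mul] at hcs
  have h4 : ∑ n ∈ I, (((σ 0 n : ℕ) : ℝ) ^ 2) ^ 2 ≤ ∑ n ∈ Icc 1 X, ((σ 0 n : ℕ) : ℝ) ^ 4 := by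
    calc ∑ n ∈ I, (((σ 0 n : ℕ) : ℝ) ^ 2) ^ 2 = ∑ n ∈ I, ((σ 0 n : ℕ) : ℝ) ^ 4 :=
          sum_congr rfl fun n _ => by ring
      _ ≤ _ := sum_le_sum_of_subset_of_nonneg hI fun _ _ _ => by positivity
  have h0 : 0 ≤ ∑ n ∈ I, ((σ 0 n : ℕ) : ℝ) ^ 2 := sum_nonneg fun _ _ => by positivity
  rw [← Real.sqrt_mul (Nat.cast_nonneg _)]
  apply Real.le_sqrt_of_sq_le
  calc (∑ n ∈ I, ((σ 0 n : ℕ) : ℝ) ^ 2) ^ 2 ≤ #I * ∑ n ∈ I, (((σ 0 n : ℕ) : ℝ) ^ 2) ^ 2 := hcs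
    _ ≤ #I * ∑ n ∈ Icc 1 X, ((σ 0 n : ℕ) : ℝ) ^ 4 := by gcongr

end Literature.NumberTheory.Sieve.FriedlanderIwaniecPrimes
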